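import Mathlib.MeasureTheory.Function.L2Space
import Mathlib.MeasureTheory.Integral.Prod
import Mathlib.MeasureTheory.Integral.Bochner.SumMeasure
import Mathlib.Analysis.CStarAlgebra.Matrix
import Literature.Analysis.OperatorTheory.HermitianKernelOperator
import HarnessLib

/-!
# Stub `stub_fibrewise_insertion_op` of line `pin-the-infimum` (crux `RobustYangMillsHandover`, item 8892)

E2 (fermionic insertions in Lüscher's transfer form), layer δ2 (lead c16, wave 7): **the fibrewise
insertion operator on `L²(μ ⊗ count)`** — pure functional analysis, Mathlib only.

Let `(X, μ)` be a finite measure space, `F` a finite type, `ρ = μ ⊗ count` on `X × F`, and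
`m : X → Matrix F F ℂ` a field of matrices with measurable entries and fibrewise `ℓ² → ℓ²` operator
norm `‖m(x)‖ ≤ C` (`Matrix.toEuclideanCLM`).  Then there is a bounded operator `M` on `L²(ρ; ℂ)` with

1. `‖M‖ ≤ C`;
2. `(Mφ)(x, s) = Σ_{s'} m(x)_{s s'} φ(x, s')` a.e.;
3. for every bounded strongly measurable kernel `K` and every bounded `A` given a.e. by
   `(Aφ)(x) = ∫ K(x, y) φ(y) dρ(y)`, the composite `A ∘ M` is again such a kernel operator, with the
   insertion INSIDE the kernel at the target point,
   `k_m(x, y) = Σ_{s'} K(x, (y.1, s')) m(y.1)_{s' y.2}` (strongly measurable and bounded);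
4. `M` commutes with the fibrewise multiplication operator by `w(y.2)` whenever `m(x)` is block
   diagonal for the level sets of `w` (fermion parity).

## Proof

* Fibrewise bound (`StubFibrewiseInsertionOp.sum_norm_sq_mulVec_le`):
  `Σ_s ‖Σ_{s'} A_{s s'} v_{s'}‖² ≤ C² Σ_s ‖v_s‖²` is `‖toEuclideanCLM A (toLp 2 v)‖ ≤ C ‖toLp 2 v‖`
  read through `EuclideanSpace.norm_sq_eq`; entries are bounded by `C` (basis vectors).
* `ρ`-a.e. means `μ`-a.e. in `x` for EVERY `s` (`StubFibrewiseInsertionOp.ae_prod_count_iff`: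
  `Measure.ae_ae_of_ae_prod`, `Measure.ae_count_iff`, `quasiMeasurePreserving_fst`), so the fibrewise
  formula respects a.e. equality and sends a.e. strongly measurable functions to such.
* For `f ∈ ℒ²(ρ)`: `∫ ‖Tf‖² dρ = ∫ Σ_s ‖Tf(x,s)‖² dμ ≤ C² ∫ Σ_s ‖f(x,s)‖² dμ = C² ∫ ‖f‖² dρ` (Fubini
  `integral_prod` + `integral_count`, `integrable_prod_iff`), so `Tf ∈ ℒ²` and `φ ↦ [Tφ]` is linear and
  bounded by `C` (`LinearMap.mkContinuous`; pattern of `StubMulInvolutionOp.exists_clm_ae_mul`).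
* Composition: `(A(Mφ))(x) = ∫ K(x,y) (Tφ)(y) dρ(y)`; unscalarise both `∫ K (Tφ)` and `∫ k_m φ` as
  `∫ Σ_s … dμ`, distribute and swap the two finite sums (`Finset.sum_comm`); integrability from
  `L² ⊆ L¹` on a finite measure space and boundedness of the kernels (`Integrable.bdd_mul`).
* Parity: both composites act a.e. by explicit formulas which agree termwise, since
  `m(x)_{s s'} = 0` unless `w s = w s'`; conclude by `ContinuousLinearMap.ext`/`Lp.ext`.

Pure theorem file (no definitions); helpers in the sub-namespace `StubFibrewiseInsertionOp`.
Reed–Simon I, §VI.6 (bounded kernels on finite measure spaces, Thm. VI.23); Halmos, *A Hilbert Space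
Problem Book*, Ch. 7 (multiplication operators). [folklore]
-/

noncomputable section

namespace Summit.QuantumFields.QCD.Cruxes.RobustYangMillsHandover.PinTheInfimum

open MeasureTheory Matrix Filter
open scoped ENNReal
open Literature.Analysis.OperatorTheory (norm_toLp_sq_eq_integral_norm_sq)

namespace StubFibrewiseInsertionOp

/-! ### The fibre: `ℓ²`-operator-norm bounds for a matrix -/

section Fibre

variable {F : Type*} [Fintype F] [DecidableEq F]

/-- **Sharp fibrewise bound**: if `‖A‖_{ℓ² → ℓ²} ≤ C` then `Σ_s ‖Σ_{s'} A_{s s'} v_{s'}‖² ≤ C² Σ_s ‖v_s‖²`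
(the operator-norm inequality on `EuclideanSpace ℂ F`, `EuclideanSpace.norm_sq_eq`). [folklore] -/
theorem sum_norm_sq_mulVec_le (A : Matrix F F ℂ) {C : ℝ}
    (hA : ‖Matrix.toEuclideanCLM (𝕜 := ℂ) A‖ ≤ C) (v : F → ℂ) :
    ∑ s, ‖∑ s', A s s' * v s'‖ ^ 2 ≤ C ^ 2 * ∑ s, ‖v s‖ ^ 2 := by
  have h := (Matrix.toEuclideanCLM (𝕜 := ℂ) A).le_of_opNorm_le hA (WithLp.toLp 2 v)
  rw [Matrix.toEuclideanCLM_toLp] at h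
  have h2 : ‖(WithLp.toLp 2 (A *ᵥ v) : EuclideanSpace ℂ F)‖ ^ 2 ≤
      (C * ‖(WithLp.toLp 2 v : EuclideanSpace ℂ F)‖) ^ 2 :=
    pow_le_pow_left₀ (norm_nonneg _) h 2
  rw [mul_pow, EuclideanSpace.norm_sq_eq, EuclideanSpace.norm_sq_eq] at h2
  simpa only [PiLp.toLp_apply, Matrix.mulVec, dotProduct] using h2

/-- Entries are bounded by the `ℓ²`-operator norm: `‖A_{s s'}‖ ≤ C` (apply the fibrewise bound to the
basis vector `e_{s'}`). [folklore] -/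
theorem norm_entry_le (A : Matrix F F ℂ) {C : ℝ} (hC : 0 ≤ C)
    (hA : ‖Matrix.toEuclideanCLM (𝕜 := ℂ) A‖ ≤ C) (s s' : F) : ‖A s s'‖ ≤ C := by
  have h := sum_norm_sq_mulVec_le A hA (Pi.single s' 1)
  have h1 : ∀ t, ∑ t', A t t' * (Pi.single s' (1 : ℂ) : F → ℂ) t' = A t s' := fun t => by
    have := congr_fun (Matrix.mulVec_single_one A s') t
    simpa only [Matrix.mulVec, dotProduct, Matrix.col_apply] using this
  have h2 : ∑ t, ‖(Pi.single s' (1 : ℂ) : F → ℂ) t‖ ^ 2 = 1 := by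
    rw [Finset.sum_eq_single s' (fun t _ ht => by simp [ht])
      (fun h => (h (Finset.mem_univ _)).elim)]
    simp
  simp only [h1, h2, mul_one] at h
  have h3 : ‖A s s'‖ ^ 2 ≤ C ^ 2 :=
    (Finset.single_le_sum (fun t _ => sq_nonneg ‖A t s'‖) (Finset.mem_univ s)).trans h
  exact (sq_le_sq₀ (norm_nonneg _) hC).1 h3

end Fibre

/-! ### `μ ⊗ count` with a finite second factor -/

section ProdCount

variable {X : Type*} [MeasurableSpace X] {μ : Measure X}
  {F : Type*} [Fintype F] [MeasurableSpace F] [MeasurableSingletonClass F]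

omit [MeasurableSingletonClass F] in
/-- `ρ = μ ⊗ count`-almost everywhere means: for `μ`-a.e. `x`, for EVERY `s`
(`Measure.ae_ae_of_ae_prod`, `Measure.ae_count_iff`; conversely `quasiMeasurePreserving_fst`).
[folklore] -/
theorem ae_prod_count_iff {p : X × F → Prop} :
    (∀ᵐ z ∂(μ.prod (Measure.count : Measure F)), p z) ↔ ∀ᵐ x ∂μ, ∀ s, p (x, s) := by
  constructor
  · intro h
    have h' := Measure.ae_ae_of_ae_prod h
    simpa only [Measure.ae_count_iff] using h'
  · intro h
    have h' : ∀ᵐ z ∂(μ.prod (Measure.count : Measure F)), ∀ s, p (z.1, s) :=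
      (Measure.quasiMeasurePreserving_fst (μ := μ) (ν := (Measure.count : Measure F))).ae h
    exact h'.mono fun z hz => hz z.2

/-- **Unscalarisation** of an integrable function: `∫ h d(μ ⊗ count) = ∫ Σ_s h(x, s) dμ(x)` (Fubini
`integral_prod` and `integral_count`). [folklore] -/
theorem integral_prod_count_of_integrable [SFinite μ] {E : Type*} [NormedAddCommGroup E]
    [NormedSpace ℝ E] [CompleteSpace E] {h : X × F → E} (hh : Integrable h (μ.prod (Measure.count : Measure F))) :
    ∫ y, h y ∂(μ.prod (Measure.count : Measure F)) = ∫ x, ∑ s, h (x, s) ∂μ := by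
  rw [integral_prod h hh]
  simp only [integral_count]

/-- The fibre sums `x ↦ Σ_s h(x, s)` of a `μ ⊗ count`-integrable function are `μ`-integrable
(`Integrable.integral_prod_left`). [folklore] -/
theorem integrable_fibreSum {E : Type*} [NormedAddCommGroup E] [NormedSpace ℝ E] [CompleteSpace E]
    {h : X × F → E} (hh : Integrable h (μ.prod (Measure.count : Measure F))) :
    Integrable (fun x => ∑ s, h (x, s)) μ := by
  simpa only [integral_count] using hh.integral_prod_left

/-! ### The fibrewise formula `(T f)(x, s) = Σ_{s'} m(x)_{s s'} f(x, s')` -/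

variable (m : X → Matrix F F ℂ)

omit [MeasurableSingletonClass F] in
/-- The fibrewise formula respects `ρ`-a.e. equality (a `ρ`-null set has `μ`-null `x`-projection of
its nonempty fibres). [folklore] -/
theorem fibrewise_congr_ae {f g : X × F → ℂ} (hfg : f =ᵐ[μ.prod (Measure.count : Measure F)] g) :
    (fun y : X × F => ∑ s', m y.1 y.2 s' * f (y.1, s')) =ᵐ[μ.prod (Measure.count : Measure F)]
      fun y => ∑ s', m y.1 y.2 s' * g (y.1, s') := by
  have h := (ae_prod_count_iff (p := fun y : X × F => f y = g y)).1 hfg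
  refine (ae_prod_count_iff (μ := μ) (F := F)).2 ?_
  filter_upwards [h] with x hx s
  simp only [hx]

variable {m}

/-- The fibrewise formula applied to a measurable function is measurable (entries of `m` measurable,
countable second factor). [folklore] -/
theorem measurable_fibrewise (hm : ∀ s s', Measurable fun x => m x s s') {g : X × F → ℂ}
    (hg : Measurable g) : Measurable fun y : X × F => ∑ s', m y.1 y.2 s' * g (y.1, s') := by
  refine Finset.measurable_sum _ fun s' _ => ?_
  refine Measurable.mul ?_ (hg.comp (measurable_fst.prodMk measurable_const))
  exact measurable_from_prod_countable_left (f := fun y : X × F => m y.1 y.2 s') fun s => hm s s'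

/-- The fibrewise formula applied to an a.e. strongly measurable function is a.e. strongly
measurable. [folklore] -/
theorem aestronglyMeasurable_fibrewise (hm : ∀ s s', Measurable fun x => m x s s') {f : X × F → ℂ}
    (hf : AEStronglyMeasurable f (μ.prod (Measure.count : Measure F))) :
    AEStronglyMeasurable (fun y : X × F => ∑ s', m y.1 y.2 s' * f (y.1, s'))
      (μ.prod (Measure.count : Measure F)) :=
  ⟨fun y => ∑ s', m y.1 y.2 s' * hf.mk f (y.1, s'),
    (measurable_fibrewise hm hf.stronglyMeasurable_mk.measurable).stronglyMeasurable,
    fibrewise_congr_ae m hf.ae_eq_mk⟩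

variable [DecidableEq F] {C : ℝ}

/-- **`ℒ²`-boundedness of the fibrewise formula**: for `f ∈ ℒ²(μ ⊗ count)`, `Tf ∈ ℒ²` and
`∫ ‖Tf‖² ≤ C² ∫ ‖f‖²` (Fubini on `μ ⊗ count` and the sharp fibrewise bound). [folklore] -/
theorem memLp_fibrewise [SFinite μ] (hm : ∀ s s', Measurable fun x => m x s s')
    (hmC : ∀ x, ‖Matrix.toEuclideanCLM (𝕜 := ℂ) (m x)‖ ≤ C) {f : X × F → ℂ}
    (hf : MemLp f 2 (μ.prod (Measure.count : Measure F))) :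
    MemLp (fun y : X × F => ∑ s', m y.1 y.2 s' * f (y.1, s')) 2 (μ.prod (Measure.count : Measure F)) ∧
      ∫ y, ‖∑ s', m y.1 y.2 s' * f (y.1, s')‖ ^ 2 ∂(μ.prod (Measure.count : Measure F)) ≤
        C ^ 2 * ∫ y, ‖f y‖ ^ 2 ∂(μ.prod (Measure.count : Measure F)) := by
  have hTm := aestronglyMeasurable_fibrewise hm hf.1
  have hf2 : Integrable (fun y => ‖f y‖ ^ 2) (μ.prod (Measure.count : Measure F)) :=
    (memLp_two_iff_integrable_sq_norm hf.1).1 hf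
  have hfib : Integrable (fun x => ∑ s, ‖f (x, s)‖ ^ 2) μ := integrable_fibreSum hf2
  have hpt : ∀ x, ∑ s, ‖∑ s', m x s s' * f (x, s')‖ ^ 2 ≤ C ^ 2 * ∑ s, ‖f (x, s)‖ ^ 2 := fun x =>
    sum_norm_sq_mulVec_le (m x) (hmC x) fun s => f (x, s)
  have hT2m : AEStronglyMeasurable (fun y : X × F => ‖∑ s', m y.1 y.2 s' * f (y.1, s')‖ ^ 2)
      (μ.prod (Measure.count : Measure F)) :=
    (hTm.norm.aemeasurable.pow_const 2).aestronglyMeasurable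
  have hT2 : Integrable (fun y : X × F => ‖∑ s', m y.1 y.2 s' * f (y.1, s')‖ ^ 2)
      (μ.prod (Measure.count : Measure F)) := by
    rw [integrable_prod_iff hT2m]
    refine ⟨Eventually.of_forall fun x => Integrable.of_finite, ?_⟩
    refine (hfib.const_mul (C ^ 2)).mono' hT2m.norm.integral_prod_right'
      (Eventually.of_forall fun x => ?_)
    rw [integral_count, Real.norm_of_nonneg (Finset.sum_nonneg fun s _ => norm_nonneg _)]
    simpa only [norm_pow, norm_norm] using hpt x
  refine ⟨(memLp_two_iff_integrable_sq_norm hTm).2 hT2, ?_⟩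
  rw [integral_prod_count_of_integrable hT2, integral_prod_count_of_integrable hf2,
    ← integral_const_mul]
  exact integral_mono (integrable_fibreSum hT2) (hfib.const_mul _) hpt

/-- **The fibrewise insertion operator exists**: a bounded `M` on `L²(μ ⊗ count)` with `‖M‖ ≤ C` and
`Mφ = Tφ` a.e. (`LinearMap.mkContinuous`; well defined on classes by `fibrewise_congr_ae`).
[folklore] -/
theorem exists_clm [SFinite μ] (hm : ∀ s s', Measurable fun x => m x s s') (hC : 0 ≤ C)
    (hmC : ∀ x, ‖Matrix.toEuclideanCLM (𝕜 := ℂ) (m x)‖ ≤ C) :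
    ∃ M : Lp ℂ 2 (μ.prod (Measure.count : Measure F)) →L[ℂ] Lp ℂ 2 (μ.prod (Measure.count : Measure F)),
      ‖M‖ ≤ C ∧
      ∀ φ : Lp ℂ 2 (μ.prod (Measure.count : Measure F)),
        (M φ : X × F → ℂ) =ᵐ[μ.prod (Measure.count : Measure F)]
          fun y => ∑ s', m y.1 y.2 s' * φ (y.1, s') := by
  have hmem : ∀ φ : Lp ℂ 2 (μ.prod (Measure.count : Measure F)),
      MemLp (fun y : X × F => ∑ s', m y.1 y.2 s' * φ (y.1, s')) 2 (μ.prod (Measure.count : Measure F)) :=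
    fun φ => (memLp_fibrewise hm hmC (Lp.memLp φ)).1
  let L : Lp ℂ 2 (μ.prod (Measure.count : Measure F)) →ₗ[ℂ] Lp ℂ 2 (μ.prod (Measure.count : Measure F)) :=
    { toFun := fun φ => (hmem φ).toLp _
      map_add' := fun φ ψ => by
        rw [← MemLp.toLp_add (hmem φ) (hmem ψ), MemLp.toLp_eq_toLp_iff]
        refine (fibrewise_congr_ae m (Lp.coeFn_add φ ψ)).trans (Eventually.of_forall fun y => ?_)
        simp only [Pi.add_apply, mul_add, Finset.sum_add_distrib]
      map_smul' := fun c φ => by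
        rw [RingHom.id_apply, ← MemLp.toLp_const_smul, MemLp.toLp_eq_toLp_iff]
        refine (fibrewise_congr_ae m (Lp.coeFn_smul c φ)).trans (Eventually.of_forall fun y => ?_)
        simp only [Pi.smul_apply, smul_eq_mul, Finset.mul_sum]
        exact Finset.sum_congr rfl fun s' _ => by ring }
  have hL : ∀ φ : Lp ℂ 2 (μ.prod (Measure.count : Measure F)),
      (L φ : X × F → ℂ) =ᵐ[μ.prod (Measure.count : Measure F)]
        fun y => ∑ s', m y.1 y.2 s' * φ (y.1, s') := fun φ => (hmem φ).coeFn_toLp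
  have hbound : ∀ φ : Lp ℂ 2 (μ.prod (Measure.count : Measure F)), ‖L φ‖ ≤ C * ‖φ‖ := by
    intro φ
    have h1 : ‖L φ‖ ^ 2 ≤ (C * ‖φ‖) ^ 2 := by
      have h2 := norm_toLp_sq_eq_integral_norm_sq (Lp.memLp φ)
      rw [Lp.toLp_coeFn] at h2
      change ‖(hmem φ).toLp _‖ ^ 2 ≤ _
      rw [mul_pow, norm_toLp_sq_eq_integral_norm_sq (hmem φ), h2]
      exact (memLp_fibrewise hm hmC (Lp.memLp φ)).2
    exact (sq_le_sq₀ (norm_nonneg _) (by positivity)).1 h1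
  exact ⟨L.mkContinuous C hbound, L.mkContinuous_norm_le hC hbound, fun φ => hL φ⟩

/-! ### Composition with a kernel operator: the insertion moves inside the kernel -/

omit [DecidableEq F] in
/-- The inserted kernel `k_m(x, y) = Σ_{s'} K(x, (y.1, s')) m(y.1)_{s' y.2}` is strongly measurable.
[folklore] -/
theorem stronglyMeasurable_insertedKernel (hm : ∀ s s', Measurable fun x => m x s s')
    {K : X × F → X × F → ℂ} (hK : StronglyMeasurable (Function.uncurry K)) :
    StronglyMeasurable (Function.uncurry fun x y : X × F => ∑ s', K x (y.1, s') * m y.1 s' y.2) := by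
  refine Measurable.stronglyMeasurable ?_
  change Measurable fun p : (X × F) × (X × F) => ∑ s', K p.1 (p.2.1, s') * m p.2.1 s' p.2.2
  refine Finset.measurable_sum _ fun s' _ => Measurable.mul ?_ ?_
  · exact hK.measurable.comp
      (measurable_fst.prodMk ((measurable_fst.comp measurable_snd).prodMk measurable_const))
  · exact (measurable_from_prod_countable_left (f := fun y : X × F => m y.1 s' y.2)
      fun s => hm s' s).comp measurable_snd

omit [MeasurableSpace X] [MeasurableSpace F] [MeasurableSingletonClass F] in
/-- The inserted kernel is bounded: `‖k_m(x, y)‖ ≤ Σ_{s'} C_K C`. [folklore] -/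
theorem norm_insertedKernel_le (hC : 0 ≤ C) (hmC : ∀ x, ‖Matrix.toEuclideanCLM (𝕜 := ℂ) (m x)‖ ≤ C)
    {K : X × F → X × F → ℂ} {CK : ℝ} (hCK : ∀ x y, ‖K x y‖ ≤ CK) (x y : X × F) :
    ‖∑ s', K x (y.1, s') * m y.1 s' y.2‖ ≤ ∑ _s' : F, CK * C := by
  refine (norm_sum_le _ _).trans (Finset.sum_le_sum fun s' _ => ?_)
  rw [norm_mul]
  exact mul_le_mul (hCK _ _) (norm_entry_le (m y.1) hC (hmC y.1) s' y.2) (norm_nonneg _)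
    ((norm_nonneg _).trans (hCK x (y.1, s')))

/-- **Moving the insertion inside the kernel**: for `f ∈ ℒ²`,
`∫ K(x, y) (Tf)(y) dρ(y) = ∫ k_m(x, y) f(y) dρ(y)` (unscalarise both sides, distribute, swap the two
finite sums). [folklore] -/
theorem integral_kernel_mul_fibrewise [IsFiniteMeasure μ] (hm : ∀ s s', Measurable fun x => m x s s')
    (hC : 0 ≤ C) (hmC : ∀ x, ‖Matrix.toEuclideanCLM (𝕜 := ℂ) (m x)‖ ≤ C)
    {K : X × F → X × F → ℂ} {CK : ℝ} (hK : StronglyMeasurable (Function.uncurry K))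
    (hCK : ∀ x y, ‖K x y‖ ≤ CK) {f : X × F → ℂ} (hf : MemLp f 2 (μ.prod (Measure.count : Measure F)))
    (x : X × F) :
    ∫ y, K x y * (∑ s', m y.1 y.2 s' * f (y.1, s')) ∂(μ.prod (Measure.count : Measure F)) =
      ∫ y, (∑ s', K x (y.1, s') * m y.1 s' y.2) * f y ∂(μ.prod (Measure.count : Measure F)) := by
  have hTf := (memLp_fibrewise hm hmC hf).1
  have hI1 : Integrable (fun y : X × F => K x y * (∑ s', m y.1 y.2 s' * f (y.1, s')))
      (μ.prod (Measure.count : Measure F)) :=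
    (hTf.integrable one_le_two).bdd_mul (hK.of_uncurry_left (x := x)).aestronglyMeasurable
      (Eventually.of_forall fun y => hCK x y)
  have hI2 : Integrable (fun y : X × F => (∑ s', K x (y.1, s') * m y.1 s' y.2) * f y)
      (μ.prod (Measure.count : Measure F)) :=
    (hf.integrable one_le_two).bdd_mul
      ((stronglyMeasurable_insertedKernel hm hK).of_uncurry_left (x := x)).aestronglyMeasurable
      (Eventually.of_forall fun y => norm_insertedKernel_le hC hmC hCK x y)
  rw [integral_prod_count_of_integrable hI1, integral_prod_count_of_integrable hI2]
  refine integral_congr_ae (Eventually.of_forall fun x' => ?_)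
  calc ∑ s, K x (x', s) * ∑ s', m x' s s' * f (x', s')
      = ∑ s, ∑ s', K x (x', s) * m x' s s' * f (x', s') := by
        simp only [Finset.mul_sum, mul_assoc]
    _ = ∑ s', ∑ s, K x (x', s) * m x' s s' * f (x', s') := Finset.sum_comm
    _ = ∑ s', (∑ s, K x (x', s) * m x' s s') * f (x', s') := by
        simp only [Finset.sum_mul]

/-- **`A ∘ M` is the kernel operator of the inserted kernel**, a.e. [folklore] -/
theorem comp_ae_insertedKernel [IsFiniteMeasure μ] (hm : ∀ s s', Measurable fun x => m x s s')
    (hC : 0 ≤ C) (hmC : ∀ x, ‖Matrix.toEuclideanCLM (𝕜 := ℂ) (m x)‖ ≤ C)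
    {M : Lp ℂ 2 (μ.prod (Measure.count : Measure F)) →L[ℂ] Lp ℂ 2 (μ.prod (Measure.count : Measure F))}
    (hM : ∀ φ : Lp ℂ 2 (μ.prod (Measure.count : Measure F)),
      (M φ : X × F → ℂ) =ᵐ[μ.prod (Measure.count : Measure F)] fun y => ∑ s', m y.1 y.2 s' * φ (y.1, s'))
    {K : X × F → X × F → ℂ} {CK : ℝ} (hK : StronglyMeasurable (Function.uncurry K))
    (hCK : ∀ x y, ‖K x y‖ ≤ CK)
    {A : Lp ℂ 2 (μ.prod (Measure.count : Measure F)) →L[ℂ] Lp ℂ 2 (μ.prod (Measure.count : Measure F))}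
    (hA : ∀ φ : Lp ℂ 2 (μ.prod (Measure.count : Measure F)),
      (A φ : X × F → ℂ) =ᵐ[μ.prod (Measure.count : Measure F)]
        fun x => ∫ y, K x y * φ y ∂(μ.prod (Measure.count : Measure F)))
    (φ : Lp ℂ 2 (μ.prod (Measure.count : Measure F))) :
    ((A.comp M) φ : X × F → ℂ) =ᵐ[μ.prod (Measure.count : Measure F)]
      fun x => ∫ y, (∑ s', K x (y.1, s') * m y.1 s' y.2) * φ y ∂(μ.prod (Measure.count : Measure F)) := by
  rw [ContinuousLinearMap.comp_apply]
  filter_upwards [hA (M φ)] with x hx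
  rw [hx, ← integral_kernel_mul_fibrewise hm hC hmC hK hCK (Lp.memLp φ) x]
  exact integral_congr_ae ((hM φ).mono fun y hy => by simp only [hy])

/-! ### Parity: block-diagonal insertions commute with the fibrewise sign -/

omit [MeasurableSingletonClass F] [DecidableEq F] in
/-- **Commutation with a fibrewise multiplication operator**: if `m(x)_{s s'} = 0` unless
`w s = w s'`, then `M ∘ F = F ∘ M` for every `F` acting a.e. by `φ ↦ w(y.2) φ(y)` (both composites act
a.e. by formulas that agree termwise; `Lp.ext`). [folklore] -/
theorem comp_eq_comp_of_blockDiagonal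
    {M : Lp ℂ 2 (μ.prod (Measure.count : Measure F)) →L[ℂ] Lp ℂ 2 (μ.prod (Measure.count : Measure F))}
    (hM : ∀ φ : Lp ℂ 2 (μ.prod (Measure.count : Measure F)),
      (M φ : X × F → ℂ) =ᵐ[μ.prod (Measure.count : Measure F)] fun y => ∑ s', m y.1 y.2 s' * φ (y.1, s'))
    {w : F → ℂ} (hw : ∀ x s s', w s ≠ w s' → m x s s' = 0)
    {Fop : Lp ℂ 2 (μ.prod (Measure.count : Measure F)) →L[ℂ] Lp ℂ 2 (μ.prod (Measure.count : Measure F))}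
    (hF : ∀ φ : Lp ℂ 2 (μ.prod (Measure.count : Measure F)),
      (Fop φ : X × F → ℂ) =ᵐ[μ.prod (Measure.count : Measure F)] fun y => w y.2 * φ y) :
    M.comp Fop = Fop.comp M := by
  refine ContinuousLinearMap.ext fun φ => Lp.ext ?_
  rw [ContinuousLinearMap.comp_apply, ContinuousLinearMap.comp_apply]
  have h1 : (M (Fop φ) : X × F → ℂ) =ᵐ[μ.prod (Measure.count : Measure F)]
      fun y => ∑ s', m y.1 y.2 s' * (w s' * φ (y.1, s')) := by
    filter_upwards [hM (Fop φ), fibrewise_congr_ae m (hF φ)] with y hy hy'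
    rw [hy, hy']
  have h2 : (Fop (M φ) : X × F → ℂ) =ᵐ[μ.prod (Measure.count : Measure F)]
      fun y => w y.2 * ∑ s', m y.1 y.2 s' * φ (y.1, s') := by
    filter_upwards [hF (M φ), hM φ] with y hy hy'
    rw [hy, hy']
  filter_upwards [h1, h2] with y hy1 hy2
  rw [hy1, hy2, Finset.mul_sum]
  refine Finset.sum_congr rfl fun s' _ => ?_
  by_cases hws : w y.2 = w s'
  · rw [hws]; ring
  · rw [hw y.1 y.2 s' hws]; ring

end ProdCount

end StubFibrewiseInsertionOp

open StubFibrewiseInsertionOp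

/-- **δ2 (registered stub `stub_fibrewise_insertion_op`): the fibrewise insertion operator on
`L²(μ ⊗ count)`.**  For a finite measure `μ` on `X`, a finite fibre type `F`, and a field of matrices
`m : X → Matrix F F ℂ` with measurable entries and fibrewise `ℓ²`-operator norm `≤ C`, there is a bounded
`M` on `L²(μ ⊗ count; ℂ)` with `‖M‖ ≤ C`, acting a.e. by `(Mφ)(x, s) = Σ_{s'} m(x)_{s s'} φ(x, s')`; for
every bounded operator `A` given a.e. by a bounded strongly measurable kernel `K`, `A ∘ M` is given
a.e. by the bounded strongly measurable inserted kernel `k_m(x, y) = Σ_{s'} K(x, (y.1, s')) m(y.1)_{s' y.2}`;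
and `M` commutes with every fibrewise multiplication operator by `w(y.2)` for which `m` is block
diagonal.  In E2, `m(U)` is a quark-bilinear Fock insertion on the slice and `w` the fermion parity.
[folklore] -/
theorem stub_fibrewise_insertion_op :
    ∀ (X : Type) [MeasurableSpace X] (μ : Measure X) [IsFiniteMeasure μ] (F : Type) [Fintype F] [DecidableEq F]
      [MeasurableSpace F] [MeasurableSingletonClass F] (m : X → Matrix F F ℂ) (C : ℝ),
      0 ≤ C → (∀ s s', Measurable fun x => m x s s') → (∀ x, ‖Matrix.toEuclideanCLM (𝕜 := ℂ) (m x)‖ ≤ C) →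
      ∃ M : Lp ℂ 2 (μ.prod (Measure.count : Measure F)) →L[ℂ] Lp ℂ 2 (μ.prod (Measure.count : Measure F)),
        ‖M‖ ≤ C ∧
        (∀ φ : Lp ℂ 2 (μ.prod (Measure.count : Measure F)),
          (M φ : X × F → ℂ) =ᵐ[μ.prod (Measure.count : Measure F)] fun y => ∑ s' : F, m y.1 y.2 s' * φ (y.1, s')) ∧
        (∀ (K : X × F → X × F → ℂ) (CK : ℝ), StronglyMeasurable (Function.uncurry K) → (∀ x y, ‖K x y‖ ≤ CK) →
          ∀ A : Lp ℂ 2 (μ.prod (Measure.count : Measure F)) →L[ℂ] Lp ℂ 2 (μ.prod (Measure.count : Measure F)),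
            (∀ φ : Lp ℂ 2 (μ.prod (Measure.count : Measure F)),
              (A φ : X × F → ℂ) =ᵐ[μ.prod (Measure.count : Measure F)] fun x => ∫ y, K x y * φ y ∂(μ.prod (Measure.count : Measure F))) →
            StronglyMeasurable (Function.uncurry fun (x y : X × F) => ∑ s' : F, K x (y.1, s') * m y.1 s' y.2) ∧
            (∃ CK' : ℝ, ∀ x y : X × F, ‖∑ s' : F, K x (y.1, s') * m y.1 s' y.2‖ ≤ CK') ∧
            (∀ φ : Lp ℂ 2 (μ.prod (Measure.count : Measure F)),
              ((A.comp M) φ : X × F → ℂ) =ᵐ[μ.prod (Measure.count : Measure F)]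
                fun x => ∫ y, (∑ s' : F, K x (y.1, s') * m y.1 s' y.2) * φ y ∂(μ.prod (Measure.count : Measure F)))) ∧
        (∀ (w : F → ℂ), (∀ x s s', w s ≠ w s' → m x s s' = 0) →
          ∀ Fop : Lp ℂ 2 (μ.prod (Measure.count : Measure F)) →L[ℂ] Lp ℂ 2 (μ.prod (Measure.count : Measure F)),
            (∀ φ : Lp ℂ 2 (μ.prod (Measure.count : Measure F)),
              (Fop φ : X × F → ℂ) =ᵐ[μ.prod (Measure.count : Measure F)] fun y => w y.2 * φ y) →
            M.comp Fop = Fop.comp M) := by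
  intro X _ μ _ F _ _ _ _ m C hC hm hmC
  obtain ⟨M, hMn, hM⟩ := exists_clm (μ := μ) hm hC hmC
  refine ⟨M, hMn, hM, fun K CK hK hCK A hA => ⟨stronglyMeasurable_insertedKernel hm hK,
    ⟨∑ _s' : F, CK * C, norm_insertedKernel_le hC hmC hCK⟩,
    fun φ => comp_ae_insertedKernel hm hC hmC hM hK hCK hA φ⟩,
    fun w hw Fop hF => comp_eq_comp_of_blockDiagonal hM hw hF⟩

end Summit.QuantumFields.QCD.Cruxes.RobustYangMillsHandover.PinTheInfimum

end
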